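import Mathlib
import Literature.MathematicalPhysics.StatisticalMechanics.CrystallizationSymmetries
import Literature.Dynamics.Ergodic.WindowDeficitCorrector
import Summits.AtomisticToContinuum.Crystallization.Theorems.NashClassCertificatesNashNearFieldStubCauchyBornBarlowCoercivity
import Summits.AtomisticToContinuum.Crystallization.Theorems.NashClassCertificatesNashNearFieldStubCauchyBornSitewiseOfCoercivityWindow

/-!
# Route `NashClassCertificates`, crux `NashNearField` (stmt-AtomisticToContinuum-16827), line `birth`:
# the stub `stub_cauchyBornSitewiseOfCoercivity` (CBBC ⇒ CBBC-sitewise)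

From the Cauchy–Born coercivity of the homogeneously deformed periodic Barlow stackings (CBBC: for `G` in the
`4/5–6/5` tube that is `r`-far from the box family on the unit-template sites of norm `≤ 3`, the energy per
particle of `G · T_s` is `≥ e⋆ + κ r²`) to its SITEWISE form: the site lattice sum of the strained stacking at every
layer `m` is `≥ e⋆ + κ r²` up to a nearest-neighbour inter-layer transfer `w (m-1) - w m` with `|w| ≤ Cw`, the
constant `Cw` being UNIFORM in the word.

* `sw_window_lower_bound` — **the uniform window bound**: the far-from-family premise only reads the letters
  `s(-3..2)`, so every window `s(m..n)` can be spliced behind them into one period of a periodic Hägg word `t`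
  (`sw_exists_splice`) to which CBBC applies with the SAME `r` (`sw_famFar_of_agree`); the energy identification for linear
  images (`energyPerParticle_linearImage_barlow_eq_average`) bounds the period sum of the strained site energies of `t`
  from below by `(n - m + 7)(e⋆ + κ r²)`, the six padding layers cost at most `73440` (`sw_abs_site_le`), and on the
  window the site energies of `t` and `s` differ by a summable amount (`sw_cmp_tsum_le`, total `≤ 25920`):
  `∑_{k=m}^{n} S_s(k) ≥ (n - m + 1)(e⋆ + κ r²) - C_win` with `C_win = 99360 + 6 |e⋆|`;
* `stub_cauchyBornSitewiseOfCoercivity` — the stub: the window-deficit corrector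
  (`Literature.Dynamics.Ergodic.exists_corrector_of_window_sum_ge`, the left Mañé potential) turns the bounded-below
  window sums of `S_G(k) - e⋆ - κ r²` into the pointwise inequality up to the bounded coboundary `w (m-1) - w m`,
  `|w| ≤ C_win`; the continuous linear `G` of the conclusion is upgraded to the automorphism CBBC speaks about by
  injectivity (`(4/5)‖v‖ ≤ ‖G v‖`) in finite dimension (`sw_exists_cle`), and the site lattice sum is rewritten in the
  punctured form of the conclusion (`sw_site_eq_conclusion`).

All `[folklore]` given CBBC (the hypothesis).
-/

noncomputable section

open scoped BigOperators
open Literature.MathematicalPhysics.StatisticalMechanics Literature.Geometry.DiscreteGeometry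

namespace Summit.AtomisticToContinuum.Crystallization.Theorems.NashClassCertificatesNashNearField



/-- **The uniform window bound.**  Let `G` be a continuous linear map with `‖G v‖ ≥ (4/5)‖v‖`, `G'` a continuous
linear automorphism with the same values, and suppose CBBC for `G'` at the level `e⋆ + κ r²` (`κ r² ≥ 0`): every
periodic Hägg word `t` whose unit template is `r`-far (on the sites of norm `≤ 3`) from the box family has
`e⋆ + κ r² ≤ e(G' · T_t)`.  Then for every Hägg word `s` that is `r`-far from the family and every window `[m, n]`,
`(n - m + 1)(e⋆ + κ r²) - (99360 + 6|e⋆|) ≤ ∑_{k=m}^{n} S_s(k)`, `S_s(k) = ½ ∑'_q V_LJ (dist (G x_k) (G x_q))` the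
strained site energy at layer `k`. [folklore] -/
theorem sw_window_lower_bound (G : EuclideanSpace ℝ (Fin 3) →L[ℝ] EuclideanSpace ℝ (Fin 3)) (hG : ∀ v, 4 / 5 * ‖v‖ ≤ ‖G v‖)
    (G' : EuclideanSpace ℝ (Fin 3) ≃L[ℝ] EuclideanSpace ℝ (Fin 3)) (hGG' : ∀ x, G' x = G x) {κ r : ℝ} (hκr : 0 ≤ κ * r ^ 2)
    (hCB : ∀ (t : ℤ → ℤ) (P : ℕ) (hP : P ≠ 0) (ht : ∀ i, t (i + P) = t i), IsHaggSeq t →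
      (∀ (A : EuclideanSpace ℝ (Fin 3) →ₗᵢ[ℝ] EuclideanSpace ℝ (Fin 3)) (a h : ℝ), 47 / 50 ≤ a → a ≤ 1 → 39 / 50 * a ≤ h → h ≤ 17 / 20 * a →
        ∃ k u v : ℤ, ‖barlowPos 1 (Real.sqrt 6 / 3) t k u v‖ ≤ 3 ∧
          r ≤ dist (G' (barlowPos 1 (Real.sqrt 6 / 3) t k u v)) (A (barlowPos a h t k u v))) →
      (⨅ Q : PeriodicConfiguration 3, Q.energyPerParticle lennardJones) + κ * r ^ 2 ≤
        ((barlowPeriodicConfiguration t one_ne_zero sw_h0_ne hP ht).linearImage G').energyPerParticle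
          lennardJones)
    (s : ℤ → ℤ) (hs : IsHaggSeq s)
    (hfar : ∀ (A : EuclideanSpace ℝ (Fin 3) →ₗᵢ[ℝ] EuclideanSpace ℝ (Fin 3)) (a h : ℝ), 47 / 50 ≤ a → a ≤ 1 → 39 / 50 * a ≤ h → h ≤ 17 / 20 * a →
      ∃ k u v : ℤ, ‖barlowPos 1 (Real.sqrt 6 / 3) s k u v‖ ≤ 3 ∧
        r ≤ dist (G (barlowPos 1 (Real.sqrt 6 / 3) s k u v)) (A (barlowPos a h s k u v)))
    {m n : ℤ} (hmn : m ≤ n) :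
    (((n - m + 1 : ℤ)) : ℝ) * ((⨅ Q : PeriodicConfiguration 3, Q.energyPerParticle lennardJones) + κ * r ^ 2) - (99360 + 6 * |(⨅ Q : PeriodicConfiguration 3, Q.energyPerParticle lennardJones)|) ≤ ∑ k ∈ Finset.Icc m n, (1 / 2 : ℝ) * ∑' q : ℤ × ℤ × ℤ, lennardJones (dist (G (barlowPos 1 (Real.sqrt 6 / 3) s k 0 0)) (G (barlowPos 1 (Real.sqrt 6 / 3) s q.1 q.2.1 q.2.2))) := by
  -- the spliced word
  set N : ℕ := (n - m).toNat + 1 with hNdef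
  have hN : (N : ℤ) = n - m + 1 := by rw [hNdef]; push_cast; rw [Int.toNat_of_nonneg (by omega)]
  obtain ⟨t, ht, htH, hnear, hwindow⟩ := sw_exists_splice s hs m N
  have hP : N + 6 ≠ 0 := by omega
  -- far from the family transfers to `t` and to `G'`
  have hfar_t := sw_famFar_of_agree hnear G r hfar
  have hfar_t' : ∀ (A : EuclideanSpace ℝ (Fin 3) →ₗᵢ[ℝ] EuclideanSpace ℝ (Fin 3)) (a h : ℝ), 47 / 50 ≤ a → a ≤ 1 → 39 / 50 * a ≤ h → h ≤ 17 / 20 * a →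
      ∃ k u v : ℤ, ‖barlowPos 1 (Real.sqrt 6 / 3) t k u v‖ ≤ 3 ∧
        r ≤ dist (G' (barlowPos 1 (Real.sqrt 6 / 3) t k u v)) (A (barlowPos a h t k u v)) := by
    intro A a h h1 h2 h3 h4
    obtain ⟨k, u, v, hk, hr⟩ := hfar_t A a h h1 h2 h3 h4
    exact ⟨k, u, v, hk, by rw [hGG']; exact hr⟩
  -- CBBC for `t` and the energy identification
  have hE := hCB t (N + 6) hP ht htH hfar_t'
  rw [energyPerParticle_linearImage_barlow_eq_average lennardJones lennardJones_zero one_pos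
    cbbc_sqrt_six_div_three_pos one_ne_zero sw_h0_ne hP ht G'] at hE
  simp only [hGG'] at hE
  have hPpos : (0 : ℝ) < ((N + 6 : ℕ) : ℝ) := by positivity
  have hE' : ((⨅ Q : PeriodicConfiguration 3, Q.energyPerParticle lennardJones) + κ * r ^ 2) * ((N + 6 : ℕ) : ℝ) ≤ ∑ k ∈ Finset.range (N + 6), (1 / 2 : ℝ) * ∑' q : ℤ × ℤ × ℤ, lennardJones (dist (G (barlowPos 1 (Real.sqrt 6 / 3) t k 0 0)) (G (barlowPos 1 (Real.sqrt 6 / 3) t q.1 q.2.1 q.2.2))) := by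
    exact (le_div_iff₀ hPpos).1 hE
  -- split the period into padding and window layers
  have hsplit : ∑ k ∈ Finset.range (N + 6), (1 / 2 : ℝ) * ∑' q : ℤ × ℤ × ℤ, lennardJones (dist (G (barlowPos 1 (Real.sqrt 6 / 3) t k 0 0)) (G (barlowPos 1 (Real.sqrt 6 / 3) t q.1 q.2.1 q.2.2))) =
      (∑ k ∈ Finset.range 3, (1 / 2 : ℝ) * ∑' q : ℤ × ℤ × ℤ, lennardJones (dist (G (barlowPos 1 (Real.sqrt 6 / 3) t k 0 0)) (G (barlowPos 1 (Real.sqrt 6 / 3) t q.1 q.2.1 q.2.2)))) + (∑ k ∈ Finset.Ico 3 (N + 3), (1 / 2 : ℝ) * ∑' q : ℤ × ℤ × ℤ, lennardJones (dist (G (barlowPos 1 (Real.sqrt 6 / 3) t k 0 0)) (G (barlowPos 1 (Real.sqrt 6 / 3) t q.1 q.2.1 q.2.2)))) +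
        ∑ k ∈ Finset.Ico (N + 3) (N + 6), (1 / 2 : ℝ) * ∑' q : ℤ × ℤ × ℤ, lennardJones (dist (G (barlowPos 1 (Real.sqrt 6 / 3) t k 0 0)) (G (barlowPos 1 (Real.sqrt 6 / 3) t q.1 q.2.1 q.2.2))) := by
    rw [Finset.sum_range_add_sum_Ico _ (show 3 ≤ N + 3 by omega),
      Finset.sum_range_add_sum_Ico _ (show N + 3 ≤ N + 6 by omega)]
  have hsite : ∀ k : ℤ, (1 / 2 : ℝ) * ∑' q : ℤ × ℤ × ℤ, lennardJones (dist (G (barlowPos 1 (Real.sqrt 6 / 3) t k 0 0)) (G (barlowPos 1 (Real.sqrt 6 / 3) t q.1 q.2.1 q.2.2))) ≤ (24480 : ℝ) / 2 := fun k => (abs_le.1 (sw_abs_site_le G hG t k)).2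
  have hpad1 : ∑ k ∈ Finset.range 3, (1 / 2 : ℝ) * ∑' q : ℤ × ℤ × ℤ, lennardJones (dist (G (barlowPos 1 (Real.sqrt 6 / 3) t k 0 0)) (G (barlowPos 1 (Real.sqrt 6 / 3) t q.1 q.2.1 q.2.2))) ≤ 3 * ((24480 : ℝ) / 2) := by
    calc ∑ k ∈ Finset.range 3, (1 / 2 : ℝ) * ∑' q : ℤ × ℤ × ℤ, lennardJones (dist (G (barlowPos 1 (Real.sqrt 6 / 3) t k 0 0)) (G (barlowPos 1 (Real.sqrt 6 / 3) t q.1 q.2.1 q.2.2))) ≤ ∑ _k ∈ Finset.range 3, (24480 : ℝ) / 2 :=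
          Finset.sum_le_sum fun k _ => hsite k
      _ = 3 * ((24480 : ℝ) / 2) := by rw [Finset.sum_const, Finset.card_range, nsmul_eq_mul]; norm_num
  have hpad2 : ∑ k ∈ Finset.Ico (N + 3) (N + 6), (1 / 2 : ℝ) * ∑' q : ℤ × ℤ × ℤ, lennardJones (dist (G (barlowPos 1 (Real.sqrt 6 / 3) t k 0 0)) (G (barlowPos 1 (Real.sqrt 6 / 3) t q.1 q.2.1 q.2.2))) ≤ 3 * ((24480 : ℝ) / 2) := by
    calc ∑ k ∈ Finset.Ico (N + 3) (N + 6), (1 / 2 : ℝ) * ∑' q : ℤ × ℤ × ℤ, lennardJones (dist (G (barlowPos 1 (Real.sqrt 6 / 3) t k 0 0)) (G (barlowPos 1 (Real.sqrt 6 / 3) t q.1 q.2.1 q.2.2))) ≤ ∑ _k ∈ Finset.Ico (N + 3) (N + 6), (24480 : ℝ) / 2 :=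
          Finset.sum_le_sum fun k _ => hsite k
      _ = 3 * ((24480 : ℝ) / 2) := by
          rw [Finset.sum_const, Nat.card_Ico, show N + 6 - (N + 3) = 3 by omega, nsmul_eq_mul]; norm_num
  -- the window layers: compare with `s`
  have hcmp : ∀ k ∈ Finset.Ico 3 (N + 3), (1 / 2 : ℝ) * ∑' q : ℤ × ℤ × ℤ, lennardJones (dist (G (barlowPos 1 (Real.sqrt 6 / 3) t k 0 0)) (G (barlowPos 1 (Real.sqrt 6 / 3) t q.1 q.2.1 q.2.2))) ≤ (1 / 2 : ℝ) * ∑' q : ℤ × ℤ × ℤ, lennardJones (dist (G (barlowPos 1 (Real.sqrt 6 / 3) s ((k : ℤ) + (m - 3)) 0 0)) (G (barlowPos 1 (Real.sqrt 6 / 3) s q.1 q.2.1 q.2.2))) +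
      (3240 : ℝ) * (2 * (((((k : ℤ) - 3 + 1 : ℤ)) : ℝ) ^ 2)⁻¹ + 2 * (((((N : ℤ) + 3 - k : ℤ)) : ℝ) ^ 2)⁻¹) := by
    intro k hk
    rw [Finset.mem_Ico] at hk
    have h := sw_cmp_tsum_le G hG (t := t) (t' := s) (A := 3) (B := (N : ℤ) + 3) (c := m - 3) (k := (k : ℤ))
      (fun x hx1 hx2 => hwindow x hx1 hx2) (by exact_mod_cast hk.1) (by exact_mod_cast hk.2)
    have h' := (abs_le.1 h).2
    linarith
  have hwin : ∑ k ∈ Finset.Ico 3 (N + 3), (1 / 2 : ℝ) * ∑' q : ℤ × ℤ × ℤ, lennardJones (dist (G (barlowPos 1 (Real.sqrt 6 / 3) t k 0 0)) (G (barlowPos 1 (Real.sqrt 6 / 3) t q.1 q.2.1 q.2.2))) ≤ (∑ k ∈ Finset.Icc m n, (1 / 2 : ℝ) * ∑' q : ℤ × ℤ × ℤ, lennardJones (dist (G (barlowPos 1 (Real.sqrt 6 / 3) s k 0 0)) (G (barlowPos 1 (Real.sqrt 6 / 3) s q.1 q.2.1 q.2.2)))) + 8 * (3240 : ℝ) :=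 by
    have h1 := Finset.sum_le_sum hcmp
    rw [Finset.sum_add_distrib, sw_sum_window_reindex (fun k => (1 / 2 : ℝ) * ∑' q : ℤ × ℤ × ℤ, lennardJones (dist (G (barlowPos 1 (Real.sqrt 6 / 3) s k 0 0)) (G (barlowPos 1 (Real.sqrt 6 / 3) s q.1 q.2.1 q.2.2)))) hN] at h1
    have h3 : ∑ k ∈ Finset.Ico 3 (N + 3), (3240 : ℝ) * (2 * (((((k : ℤ) - 3 + 1 : ℤ)) : ℝ) ^ 2)⁻¹ +
        2 * (((((N : ℤ) + 3 - k : ℤ)) : ℝ) ^ 2)⁻¹) ≤ (3240 : ℝ) * 8 := by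
      rw [← Finset.mul_sum]
      exact mul_le_mul_of_nonneg_left (sw_sum_window_majorant_le N) (show (0 : ℝ) ≤ 3240 by norm_num)
    linarith
  -- assemble
  have hcast : ((N + 6 : ℕ) : ℝ) = (((n - m + 1 : ℤ)) : ℝ) + 6 := by
    have : (((N + 6 : ℕ) : ℤ)) = (n - m + 1) + 6 := by push_cast; omega
    exact_mod_cast this
  have hexp : ((⨅ Q : PeriodicConfiguration 3, Q.energyPerParticle lennardJones) + κ * r ^ 2) * ((N + 6 : ℕ) : ℝ) =
      (((n - m + 1 : ℤ)) : ℝ) * ((⨅ Q : PeriodicConfiguration 3, Q.energyPerParticle lennardJones) + κ * r ^ 2) + 6 * (⨅ Q : PeriodicConfiguration 3, Q.energyPerParticle lennardJones) + 6 * (κ * r ^ 2) := by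
    rw [hcast]; ring
  have habs : -(⨅ Q : PeriodicConfiguration 3, Q.energyPerParticle lennardJones) ≤ |(⨅ Q : PeriodicConfiguration 3, Q.energyPerParticle lennardJones)| := neg_le_abs _
  linarith

/-- The strained site energy in the form of the conclusion: the punctured sum through `G (x_q - x_m)`. [folklore] -/
theorem sw_site_eq_conclusion (G : EuclideanSpace ℝ (Fin 3) →L[ℝ] EuclideanSpace ℝ (Fin 3)) (s : ℤ → ℤ) (m : ℤ) :
    (1 / 2 : ℝ) * ∑' q : ℤ × ℤ × ℤ, lennardJones (dist (G (barlowPos 1 (Real.sqrt 6 / 3) s m 0 0)) (G (barlowPos 1 (Real.sqrt 6 / 3) s q.1 q.2.1 q.2.2))) = (1 / 2 : ℝ) * (∑' q : {q : ℤ × ℤ × ℤ // q ≠ (m, 0, 0)},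
      lennardJones ‖G (barlowPos 1 (Real.sqrt 6 / 3) s q.1.1 q.1.2.1 q.1.2.2 -
        barlowPos 1 (Real.sqrt 6 / 3) s m 0 0)‖) := by
  congr 1
  have hfun : (fun q : ℤ × ℤ × ℤ => lennardJones (dist (G (barlowPos 1 (Real.sqrt 6 / 3) s m 0 0)) (G (barlowPos 1 (Real.sqrt 6 / 3) s q.1 q.2.1 q.2.2)))) = fun q : ℤ × ℤ × ℤ =>
      lennardJones ‖G (barlowPos 1 (Real.sqrt 6 / 3) s q.1 q.2.1 q.2.2 - barlowPos 1 (Real.sqrt 6 / 3) s m 0 0)‖ := by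
    funext q
    rw [dist_comm, dist_eq_norm, map_sub]
  rw [hfun]
  have hsupp : Function.support (fun q : ℤ × ℤ × ℤ =>
      lennardJones ‖G (barlowPos 1 (Real.sqrt 6 / 3) s q.1 q.2.1 q.2.2 - barlowPos 1 (Real.sqrt 6 / 3) s m 0 0)‖) ⊆
      Set.range (Subtype.val : {q : ℤ × ℤ × ℤ // q ≠ (m, 0, 0)} → ℤ × ℤ × ℤ) := by
    intro q hq
    rw [Function.mem_support] at hq
    refine ⟨⟨q, ?_⟩, rfl⟩
    rintro rfl
    apply hq
    simp [lennardJones_zero]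
  exact (Subtype.val_injective.tsum_eq hsupp).symm

/-- A continuous linear map of `ℝ³` with `(4/5)‖v‖ ≤ ‖G v‖` is a continuous linear automorphism with the same values.
[folklore] -/
theorem sw_exists_cle (G : EuclideanSpace ℝ (Fin 3) →L[ℝ] EuclideanSpace ℝ (Fin 3)) (hG : ∀ v, 4 / 5 * ‖v‖ ≤ ‖G v‖) :
    ∃ G' : EuclideanSpace ℝ (Fin 3) ≃L[ℝ] EuclideanSpace ℝ (Fin 3), ∀ x, G' x = G x := by
  have hinj : Function.Injective G := by
    intro x y hxy
    have h := hG (x - y)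
    rw [map_sub, hxy, sub_self, norm_zero] at h
    have h0 : ‖x - y‖ = 0 := le_antisymm (by linarith [norm_nonneg (x - y)]) (norm_nonneg _)
    exact sub_eq_zero.1 (norm_eq_zero.1 h0)
  exact ⟨(LinearEquiv.ofInjectiveEndo G.toLinearMap hinj).toContinuousLinearEquiv, fun x => by simp⟩

/-- **Stub `stub_cauchyBornSitewiseOfCoercivity` (CBBC ⇒ CBBC-sitewise), proved.**  If for some `κ > 0` every
periodic Hägg word `s`, every continuous linear automorphism `G` in the `4/5–6/5` tube and every `r ∈ [0, 1/10]`
with `G` `r`-far (on the unit-template sites of norm `≤ 3`) from every box-scaled isometric copy of the template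
satisfy `e⋆ + κ r² ≤ e(G · T_s)`, then with the SAME `κ` and a constant `Cw` uniform in the word, for every such
datum (now `G` merely continuous linear in the tube) there is `w : ℤ → ℝ` with `|w| ≤ Cw` and, at every layer `m`,
`e⋆ + κ r² ≤ ½ ∑'_{q ≠ (m,0,0)} V_LJ ‖G (x_q - x_m)‖ + w (m-1) - w m`.  Ingredients: splicing of windows into
periodic words behind the six letters read by the far-from-family premise, the energy identification for linear
images, `d⁻⁴` locality of the strained layer sums (uniform window bound `sw_window_lower_bound`), and the
window-deficit corrector. [folklore] -/
theorem stub_cauchyBornSitewiseOfCoercivity :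
    (∃ κ : ℝ, 0 < κ ∧ ∀ (s : ℤ → ℤ) (p : ℕ) (hp : p ≠ 0) (hs : ∀ i, s (i + p) = s i), IsHaggSeq s →
      ∀ (G : EuclideanSpace ℝ (Fin 3) ≃L[ℝ] EuclideanSpace ℝ (Fin 3)),
        (∀ v : EuclideanSpace ℝ (Fin 3), 4 / 5 * ‖v‖ ≤ ‖G v‖ ∧ ‖G v‖ ≤ 6 / 5 * ‖v‖) →
        ∀ r : ℝ, 0 ≤ r → r ≤ 1 / 10 →
          (∀ (A : EuclideanSpace ℝ (Fin 3) →ₗᵢ[ℝ] EuclideanSpace ℝ (Fin 3)) (a h : ℝ), 47 / 50 ≤ a → a ≤ 1 → 39 / 50 * a ≤ h → h ≤ 17 / 20 * a →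
            ∃ m u v : ℤ, ‖barlowPos 1 (Real.sqrt 6 / 3) s m u v‖ ≤ 3 ∧
              r ≤ dist (G (barlowPos 1 (Real.sqrt 6 / 3) s m u v)) (A (barlowPos a h s m u v))) →
          (⨅ Q : PeriodicConfiguration 3, Q.energyPerParticle lennardJones) + κ * r ^ 2 ≤
            ((barlowPeriodicConfiguration s one_ne_zero
                (div_ne_zero (Real.sqrt_ne_zero'.2 (by norm_num)) three_ne_zero : Real.sqrt 6 / 3 ≠ 0) hp hs).linearImage
              G).energyPerParticle lennardJones) →
    ∃ κ : ℝ, 0 < κ ∧ ∃ Cw : ℝ, ∀ (s : ℤ → ℤ) (p : ℕ), p ≠ 0 → (∀ i, s (i + p) = s i) → IsHaggSeq s →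
      ∀ (G : (EuclideanSpace ℝ (Fin 3) →L[ℝ] EuclideanSpace ℝ (Fin 3))),
        (∀ v : EuclideanSpace ℝ (Fin 3), 4 / 5 * ‖v‖ ≤ ‖G v‖ ∧ ‖G v‖ ≤ 6 / 5 * ‖v‖) →
        ∀ r : ℝ, 0 ≤ r → r ≤ 1 / 10 →
          (∀ (A : EuclideanSpace ℝ (Fin 3) →ₗᵢ[ℝ] EuclideanSpace ℝ (Fin 3)) (a h : ℝ), 47 / 50 ≤ a → a ≤ 1 → 39 / 50 * a ≤ h → h ≤ 17 / 20 * a →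
            ∃ m u v : ℤ, ‖barlowPos 1 (Real.sqrt 6 / 3) s m u v‖ ≤ 3 ∧
              r ≤ dist (G (barlowPos 1 (Real.sqrt 6 / 3) s m u v)) (A (barlowPos a h s m u v))) →
          ∃ w : ℤ → ℝ, (∀ n : ℤ, |w n| ≤ Cw) ∧ ∀ m : ℤ,
            (⨅ Q : PeriodicConfiguration 3, Q.energyPerParticle lennardJones) + κ * r ^ 2 ≤
              (1 / 2 : ℝ) * (∑' q : {q : ℤ × ℤ × ℤ // q ≠ (m, 0, 0)},
                lennardJones ‖G (barlowPos 1 (Real.sqrt 6 / 3) s q.1.1 q.1.2.1 q.1.2.2 -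
                  barlowPos 1 (Real.sqrt 6 / 3) s m 0 0)‖) + w (m - 1) - w m := by
  rintro ⟨κ, hκ, hCB⟩
  refine ⟨κ, hκ, (99360 + 6 * |(⨅ Q : PeriodicConfiguration 3, Q.energyPerParticle lennardJones)|), ?_⟩
  intro s p _hp _hs hH G hG r hr0 hr1 hfar
  -- the automorphism with the same values
  obtain ⟨G', hGG'⟩ := sw_exists_cle G (fun v => (hG v).1)
  have hGlow : ∀ v : EuclideanSpace ℝ (Fin 3), 4 / 5 * ‖v‖ ≤ ‖G v‖ := fun v => (hG v).1
  have hG'tube : ∀ v : EuclideanSpace ℝ (Fin 3), 4 / 5 * ‖v‖ ≤ ‖G' v‖ ∧ ‖G' v‖ ≤ 6 / 5 * ‖v‖ := fun v => by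
    rw [hGG']; exact hG v
  have hκr : 0 ≤ κ * r ^ 2 := by positivity
  -- the uniform window bound for `f k = S_G(k) - e⋆ - κ r²`
  have hwin : ∀ m n : ℤ, m ≤ n →
      -(99360 + 6 * |(⨅ Q : PeriodicConfiguration 3, Q.energyPerParticle lennardJones)|) ≤ ∑ k ∈ Finset.Icc m n, ((1 / 2 : ℝ) * ∑' q : ℤ × ℤ × ℤ, lennardJones (dist (G (barlowPos 1 (Real.sqrt 6 / 3) s k 0 0)) (G (barlowPos 1 (Real.sqrt 6 / 3) s q.1 q.2.1 q.2.2))) - (⨅ Q : PeriodicConfiguration 3, Q.energyPerParticle lennardJones) - κ * r ^ 2) := by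
    intro m n hmn
    have h := sw_window_lower_bound G hGlow G' hGG' hκr
      (fun t P hP ht htH hfar_t => hCB t P hP ht htH G' hG'tube r hr0 hr1 hfar_t) s hH hfar hmn
    rw [Finset.sum_sub_distrib, Finset.sum_sub_distrib, Finset.sum_const, Finset.sum_const, Int.card_Icc,
      nsmul_eq_mul, nsmul_eq_mul]
    have hc : (((n + 1 - m).toNat : ℕ) : ℝ) = (((n - m + 1 : ℤ)) : ℝ) := by
      have h0 : (((n + 1 - m).toNat : ℕ) : ℤ) = n - m + 1 := by rw [Int.toNat_of_nonneg (by omega)]; ring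
      exact_mod_cast h0
    rw [hc]
    have hexp : (((n - m + 1 : ℤ)) : ℝ) * ((⨅ Q : PeriodicConfiguration 3, Q.energyPerParticle lennardJones) + κ * r ^ 2) =
        (((n - m + 1 : ℤ)) : ℝ) * (⨅ Q : PeriodicConfiguration 3, Q.energyPerParticle lennardJones) + (((n - m + 1 : ℤ)) : ℝ) * (κ * r ^ 2) := by ring
    linarith
  -- the corrector
  obtain ⟨u, g, hu, hg, hfug⟩ := Literature.Dynamics.Ergodic.exists_corrector_of_window_sum_ge hwin
  refine ⟨u, fun k => ?_, fun k => ?_⟩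
  · rw [abs_le]
    refine ⟨(hu k).1, ?_⟩
    have h1 := (hu k).2
    have h2 := (abs_le.1 (sw_abs_site_le G hGlow s k)).2
    have h3 : -(⨅ Q : PeriodicConfiguration 3, Q.energyPerParticle lennardJones) ≤ |(⨅ Q : PeriodicConfiguration 3, Q.energyPerParticle lennardJones)| := neg_le_abs _
    have h4 := (show (0 : ℝ) ≤ 24480 by norm_num)
    have h5 := (show (0 : ℝ) ≤ 3240 by norm_num)
    have h6 := abs_nonneg (⨅ Q : PeriodicConfiguration 3, Q.energyPerParticle lennardJones)
    linarith
  · have h := hfug k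
    have hgk := hg k
    rw [← sw_site_eq_conclusion G s k]
    linarith

end Summit.AtomisticToContinuum.Crystallization.Theorems.NashClassCertificatesNashNearField

end
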